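import Literature.Analysis.FluidPDE.ConvexIntegration2DPlaneWaves
import HarnessLib

/-!
# Convex integration in 2-D: localized plane waves, II (main term and `O(1/N)` remainder)

Topic `Analysis/FluidPDE`. Support file for the proof of `ConvexIntegrationLemma2DBall`
(Chiodaroli–De Lellis–Kreml 2015, Lemma 3.7 on a ball): CDK 2015, Prop. 4.1 (i) in explicit
two-dimensional form. For the wave `pot (A N⁻³ χ cos(Nφ_η))` of
`ConvexIntegration2DPlaneWaves.lean`:

* `monomial_expand`, `monomial_remainder`: each third-order monomial `∂_a∂_b∂_c g_N` equals
  `A φ_aφ_bφ_c χ sin(Nφ_η)` plus terms of size `≤ K/N` (the computation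
  "`‖U - φ A(∂)(κ)‖₀ ≤ C λ N⁻¹`" of CDK, proof of Prop. 4.1);
* `wave_eventually_close`: `|wave_N - A χ sin(Nφ_η) D| ≤ ρ` uniformly, for all large `N`
  (the image lies in a `ρ`-neighbourhood of the segment `[-A D, A D]`, Prop. 4.1 (i)).

Relation to the `(λ, a, b)` parametrisation of CDK Prop. 4.1 (`IsWaveData`/`waveVec` of
`ConvexIntegration2DGeometry.lean`): for `|n| = 1` and `0 < |μ| < √C` the chord
`a', b' = μ e ± √(C - μ²) n`, `e = (n₂, -n₁)`, has `|a'| = |b'| = √C`, `a' ≠ ±b'`, and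
`(a' - b', a' ⊗ a' - b' ⊗ b') = 2√(C - μ²) · D(n, μ)` (`waveVec_chord`, `isWaveData_chord` in
`ConvexIntegration2DGeometricLemma.lean`); so `A · Dvec` is `p = λ[(a', a'⊗a') - (b', b'⊗b')]`
with `λ = A / (2√(C - μ²))`. The wave construction itself does not need `μ ≠ 0`.

## References

* E. Chiodaroli, C. De Lellis, O. Kreml, *Global ill-posedness of the isentropic system of gas
  dynamics*, Comm. Pure Appl. Math. 68 (2015) 1157–1190, Prop. 4.1 (i) and its proof (§4.2).
-/

noncomputable section

open MeasureTheory Set Metric Filter Function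
open scoped ContDiff Topology

namespace Literature.Analysis.FluidPDE.ConvexIntegration

namespace WaveData

variable (d : WaveData)

/-! #### Main term and remainder of one third-order monomial -/

/-- Unfolding of the potential. [folklore] -/
theorem gpot_def (N : ℝ) : d.gpot N = fun z => d.amp N z * osc d.η N 0 z := rfl

/-- First derivatives of the amplitude. [folklore] -/
theorem pd_amp (N : ℝ) (e : ST) : pd e (d.amp N) = fun z => d.A / N ^ 3 * pd e d.cutoff z :=
  pd_const_mul (differentiable_of_smooth d.contDiff_cutoff) _ _

/-- Second derivatives of the amplitude. [folklore] -/
theorem pd_pd_amp (N : ℝ) (a b : ST) :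
    pd a (pd b (d.amp N)) = fun z => d.A / N ^ 3 * pd a (pd b d.cutoff) z := by
  rw [pd_amp]; exact pd_const_mul (differentiable_of_smooth (contDiff_pd d.contDiff_cutoff b)) _ _

/-- Third derivatives of the amplitude. [folklore] -/
theorem pd_pd_pd_amp (N : ℝ) (a b c : ST) :
    pd a (pd b (pd c (d.amp N))) = fun z => d.A / N ^ 3 * pd a (pd b (pd c d.cutoff)) z := by
  rw [pd_pd_amp]
  exact pd_const_mul (differentiable_of_smooth (contDiff_pd (contDiff_pd d.contDiff_cutoff c) b)) _ _

/-- Elementary bound: `|A/N·T₂o₂ + A/N²·T₁o₁ + A/N³·T₀o₀| ≤ |A|(K₂+K₁+K₀)/N` for `N ≥ 1`,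
`|Tᵢ| ≤ Kᵢ`, `|oᵢ| ≤ 1`. [folklore] -/
theorem abs_three_scales_le {A N T₂ T₁ T₀ o₂ o₁ o₀ K₂ K₁ K₀ : ℝ} (hN : 1 ≤ N)
    (h₂ : |T₂| ≤ K₂) (h₁ : |T₁| ≤ K₁) (h₀ : |T₀| ≤ K₀) (ho₂ : |o₂| ≤ 1) (ho₁ : |o₁| ≤ 1)
    (ho₀ : |o₀| ≤ 1) :
    |A / N * (T₂ * o₂) + A / N ^ 2 * (T₁ * o₁) + A / N ^ 3 * (T₀ * o₀)|
      ≤ |A| * (K₂ + K₁ + K₀) / N := by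
  have hNpos : 0 < N := by linarith
  have hK₂ : 0 ≤ K₂ := (abs_nonneg _).trans h₂
  have hK₁ : 0 ≤ K₁ := (abs_nonneg _).trans h₁
  have hK₀ : 0 ≤ K₀ := (abs_nonneg _).trans h₀
  have hTo : ∀ {T o K : ℝ}, |T| ≤ K → |o| ≤ 1 → |T * o| ≤ K := by
    intro T o K hT ho
    rw [abs_mul]
    calc _ ≤ K * 1 := mul_le_mul hT ho (abs_nonneg _) ((abs_nonneg _).trans hT)
      _ = K := mul_one K
  have hpow : ∀ k : ℕ, 1 ≤ k → N ≤ N ^ k := fun k hk => by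
    calc N = N ^ 1 := (pow_one N).symm
      _ ≤ N ^ k := pow_le_pow_right₀ hN hk
  have term : ∀ {T o K : ℝ} (k : ℕ), 1 ≤ k → |T| ≤ K → |o| ≤ 1 →
      |A / N ^ k * (T * o)| ≤ |A| * K / N := by
    intro T o K k hk hT ho
    have hKn : 0 ≤ K := (abs_nonneg _).trans hT
    rw [abs_mul, abs_div, abs_of_pos (pow_pos hNpos k)]
    calc |A| / N ^ k * |T * o| ≤ |A| / N * K := by
          apply mul_le_mul _ (hTo hT ho) (abs_nonneg _) (by positivity)
          exact div_le_div_of_nonneg_left (abs_nonneg _) hNpos (hpow k hk)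
      _ = |A| * K / N := by ring
  calc _ ≤ |A / N * (T₂ * o₂) + A / N ^ 2 * (T₁ * o₁)| + |A / N ^ 3 * (T₀ * o₀)| := abs_add_le _ _
    _ ≤ |A / N * (T₂ * o₂)| + |A / N ^ 2 * (T₁ * o₁)| + |A / N ^ 3 * (T₀ * o₀)| := by
        gcongr; exact abs_add_le _ _
    _ ≤ |A| * K₂ / N + |A| * K₁ / N + |A| * K₀ / N := by
        gcongr
        · simpa using term 1 le_rfl h₂ ho₂
        · exact term 2 (by norm_num) h₁ ho₁
        · exact term 3 (by norm_num) h₀ ho₀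
    _ = |A| * (K₂ + K₁ + K₀) / N := by ring

/-- **Expansion of one monomial of the wave.** For `N ≠ 0`,
`∂_a∂_b∂_c g_N = A φ_aφ_bφ_c χ osc₃ + A/N (…) osc₂ + A/N² (…) osc₁ + A/N³ (∂³χ) osc₀`.
[cite: ChiodaroliDeLellisKreml2015, proof of Prop. 4.1] -/
theorem monomial_expand {N : ℝ} (hN : N ≠ 0) (a b c z : ST) :
    pd a (pd b (pd c (d.gpot N))) z
      = d.A * (phaseL d.η a * phaseL d.η b * phaseL d.η c) * d.cutoff z * osc d.η N 3 z
        + (d.A / N * ((phaseL d.η a * phaseL d.η b * pd c d.cutoff z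
              + phaseL d.η a * phaseL d.η c * pd b d.cutoff z
              + phaseL d.η b * phaseL d.η c * pd a d.cutoff z) * osc d.η N 2 z)
          + d.A / N ^ 2 * ((phaseL d.η a * pd b (pd c d.cutoff) z
              + phaseL d.η b * pd a (pd c d.cutoff) z
              + phaseL d.η c * pd a (pd b d.cutoff) z) * osc d.η N 1 z)
          + d.A / N ^ 3 * (pd a (pd b (pd c d.cutoff)) z * osc d.η N 0 z)) := by
  rw [gpot_def, pd3_mul_osc d.η N (d.contDiff_amp N) 0 a b c]
  rw [d.pd_pd_pd_amp N a b c, d.pd_pd_amp N b c, d.pd_pd_amp N a c, d.pd_pd_amp N a b,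
    d.pd_amp N a, d.pd_amp N b, d.pd_amp N c]
  simp only [amp]
  field_simp
  ring

/-- **Remainder bound for one monomial:** `|∂_a∂_b∂_c g_N - A φ_aφ_bφ_c χ osc₃| ≤ K/N` for
`N ≥ 1`. [cite: ChiodaroliDeLellisKreml2015, proof of Prop. 4.1
(`‖U - φ A(∂)(κ)‖₀ ≤ C λ N⁻¹`)] -/
theorem monomial_remainder (a b c : ST) : ∃ K : ℝ, ∀ N : ℝ, 1 ≤ N → ∀ z,
    |pd a (pd b (pd c (d.gpot N))) z
      - d.A * (phaseL d.η a * phaseL d.η b * phaseL d.η c) * d.cutoff z * osc d.η N 3 z|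
      ≤ K / N := by
  have hχ := d.contDiff_cutoff
  have hχc := d.hasCompactSupport_cutoff
  -- sup bounds of the seven derivatives of the cutoff that occur
  have B : ∀ (f : ST → ℝ), ContDiff ℝ ∞ f → HasCompactSupport f →
      ∃ K : ℝ, 0 ≤ K ∧ ∀ z, |f z| ≤ K := fun f hf hfc => exists_forall_abs_le hf.continuous hfc
  have B1 : ∀ e, ∃ K : ℝ, 0 ≤ K ∧ ∀ z, |pd e d.cutoff z| ≤ K := fun e =>
    B _ (contDiff_pd hχ e) (hasCompactSupport_pd hχc e)
  have B2 : ∀ e e', ∃ K : ℝ, 0 ≤ K ∧ ∀ z, |pd e (pd e' d.cutoff) z| ≤ K := fun e e' =>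
    B _ (contDiff_pd (contDiff_pd hχ e') e) (hasCompactSupport_pd (hasCompactSupport_pd hχc e') e)
  obtain ⟨Ka, hKa, ha⟩ := B1 a
  obtain ⟨Kb, hKb, hb⟩ := B1 b
  obtain ⟨Kc, hKc, hc⟩ := B1 c
  obtain ⟨Kbc, hKbc, hbc⟩ := B2 b c
  obtain ⟨Kac, hKac, hac⟩ := B2 a c
  obtain ⟨Kab, hKab, hab⟩ := B2 a b
  obtain ⟨Kabc, hKabc, habc⟩ := B _ (contDiff_pd (contDiff_pd (contDiff_pd hχ c) b) a)
    (hasCompactSupport_pd (hasCompactSupport_pd (hasCompactSupport_pd hχc c) b) a)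
  set la := phaseL d.η a
  set lb := phaseL d.η b
  set lc := phaseL d.η c
  set K₂ : ℝ := |la * lb| * Kc + |la * lc| * Kb + |lb * lc| * Ka
  set K₁ : ℝ := |la| * Kbc + |lb| * Kac + |lc| * Kab
  refine ⟨|d.A| * (K₂ + K₁ + Kabc), fun N hN z => ?_⟩
  rw [d.monomial_expand (by linarith) a b c z, add_sub_cancel_left]
  refine abs_three_scales_le hN ?_ ?_ (habc z) (abs_osc_le_one _ _ _ _) (abs_osc_le_one _ _ _ _)
    (abs_osc_le_one _ _ _ _)
  · calc _ ≤ |la * lb * pd c d.cutoff z + la * lc * pd b d.cutoff z| + |lb * lc * pd a d.cutoff z| :=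
          abs_add_le _ _
      _ ≤ |la * lb * pd c d.cutoff z| + |la * lc * pd b d.cutoff z| + |lb * lc * pd a d.cutoff z| := by
          gcongr; exact abs_add_le _ _
      _ ≤ K₂ := by
          have t1 : |la * lb * pd c d.cutoff z| ≤ |la * lb| * Kc := by
            rw [abs_mul (la * lb)]; exact mul_le_mul_of_nonneg_left (hc z) (abs_nonneg _)
          have t2 : |la * lc * pd b d.cutoff z| ≤ |la * lc| * Kb := by
            rw [abs_mul (la * lc)]; exact mul_le_mul_of_nonneg_left (hb z) (abs_nonneg _)
          have t3 : |lb * lc * pd a d.cutoff z| ≤ |lb * lc| * Ka := by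
            rw [abs_mul (lb * lc)]; exact mul_le_mul_of_nonneg_left (ha z) (abs_nonneg _)
          simp only [K₂]
          linarith
  · calc _ ≤ |la * pd b (pd c d.cutoff) z + lb * pd a (pd c d.cutoff) z|
          + |lc * pd a (pd b d.cutoff) z| := abs_add_le _ _
      _ ≤ |la * pd b (pd c d.cutoff) z| + |lb * pd a (pd c d.cutoff) z|
          + |lc * pd a (pd b d.cutoff) z| := by gcongr; exact abs_add_le _ _
      _ ≤ K₁ := by
          have t1 : |la * pd b (pd c d.cutoff) z| ≤ |la| * Kbc := by
            rw [abs_mul]; exact mul_le_mul_of_nonneg_left (hbc z) (abs_nonneg _)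
          have t2 : |lb * pd a (pd c d.cutoff) z| ≤ |lb| * Kac := by
            rw [abs_mul]; exact mul_le_mul_of_nonneg_left (hac z) (abs_nonneg _)
          have t3 : |lc * pd a (pd b d.cutoff) z| ≤ |lc| * Kab := by
            rw [abs_mul]; exact mul_le_mul_of_nonneg_left (hab z) (abs_nonneg _)
          simp only [K₁]
          linarith

/-- Eventual form of the monomial remainder bound. [folklore] -/
theorem monomial_eventually (a b c : ST) {ρ : ℝ} (hρ : 0 < ρ) : ∀ᶠ N : ℝ in atTop, ∀ z,
    |pd a (pd b (pd c (d.gpot N))) z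
      - d.A * (phaseL d.η a * phaseL d.η b * phaseL d.η c) * d.cutoff z * osc d.η N 3 z| ≤ ρ := by
  obtain ⟨K, hK⟩ := d.monomial_remainder a b c
  filter_upwards [eventually_ge_atTop (1 : ℝ), eventually_ge_atTop (K / ρ)] with N hN hN'
  intro z
  refine (hK N hN z).trans ?_
  rw [div_le_iff₀ (by linarith)]
  calc K = K / ρ * ρ := by field_simp
    _ ≤ N * ρ := by gcongr
    _ = ρ * N := mul_comm _ _

/-! #### The wave is its main term up to a uniformly small remainder -/

/-- `D₀ = n₁`. [folklore] -/
theorem Dvec_zero : d.Dvec 0 = d.n 0 := rfl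
/-- `D₁ = n₂`. [folklore] -/
theorem Dvec_one : d.Dvec 1 = d.n 1 := rfl
/-- `D₂ = 2μn₁n₂`. [folklore] -/
theorem Dvec_two : d.Dvec 2 = 2 * d.μ * d.n 0 * d.n 1 := rfl
/-- `D₃ = μ(n₂² - n₁²)`. [folklore] -/
theorem Dvec_three : d.Dvec 3 = d.μ * (d.n 1 ^ 2 - d.n 0 ^ 2) := rfl

/-- `wave₀ = -(∂₂∂₁∂₁ + ∂₂∂₂∂₂) g_N`. [folklore] -/
theorem wave_zero_apply (N : ℝ) (z : ST) : d.wave N 0 z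
    = -(pd (dX 1) (pd (dX 0) (pd (dX 0) (d.gpot N))) z
        + pd (dX 1) (pd (dX 1) (pd (dX 1) (d.gpot N))) z) := by
  have hg := d.contDiff_gpot N
  show -pd (dX 1) (lap (d.gpot N)) z = _
  rw [lap_def, pd_add (differentiable_of_smooth (contDiff_pd (contDiff_pd hg _) _))
    (differentiable_of_smooth (contDiff_pd (contDiff_pd hg _) _))]

/-- `wave₁ = (∂₁∂₁∂₁ + ∂₁∂₂∂₂) g_N`. [folklore] -/
theorem wave_one_apply (N : ℝ) (z : ST) : d.wave N 1 z
    = pd (dX 0) (pd (dX 0) (pd (dX 0) (d.gpot N))) z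
        + pd (dX 0) (pd (dX 1) (pd (dX 1) (d.gpot N))) z := by
  have hg := d.contDiff_gpot N
  show pd (dX 0) (lap (d.gpot N)) z = _
  rw [lap_def, pd_add (differentiable_of_smooth (contDiff_pd (contDiff_pd hg _) _))
    (differentiable_of_smooth (contDiff_pd (contDiff_pd hg _) _))]

/-- `wave₂ = 2∂_t∂₁∂₂ g_N`. [folklore] -/
theorem wave_two_apply (N : ℝ) (z : ST) : d.wave N 2 z
    = 2 * pd dT (pd (dX 0) (pd (dX 1) (d.gpot N))) z := by
  have hg := d.contDiff_gpot N
  show pd dT (auxH (d.gpot N) 0) z = _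
  rw [auxH_zero, pd_const_mul (differentiable_of_smooth (contDiff_pd (contDiff_pd hg _) _))]

/-- `wave₃ = (∂_t∂₂∂₂ - ∂_t∂₁∂₁) g_N`. [folklore] -/
theorem wave_three_apply (N : ℝ) (z : ST) : d.wave N 3 z
    = pd dT (pd (dX 1) (pd (dX 1) (d.gpot N))) z
        - pd dT (pd (dX 0) (pd (dX 0) (d.gpot N))) z := by
  have hg := d.contDiff_gpot N
  show pd dT (auxH (d.gpot N) 1) z = _
  rw [auxH_one, pd_sub (differentiable_of_smooth (contDiff_pd (contDiff_pd hg _) _))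
    (differentiable_of_smooth (contDiff_pd (contDiff_pd hg _) _))]

/-- **The localized plane wave is `A χ sin(Nφ_η) D` up to `O(1/N)` uniformly**
(CDK 2015, Prop. 4.1 (i): the image lies in an `ε`-neighbourhood of the segment).
[cite: ChiodaroliDeLellisKreml2015, Prop. 4.1 (i)] -/
theorem wave_eventually_close {ρ : ℝ} (hρ : 0 < ρ) :
    ∀ᶠ N : ℝ in atTop, ∀ i z, |d.wave N i z - d.waveMain N i z| ≤ ρ := by
  have hρ2 : 0 < ρ / 2 := by linarith
  filter_upwards [d.monomial_eventually (dX 1) (dX 0) (dX 0) hρ2,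
    d.monomial_eventually (dX 1) (dX 1) (dX 1) hρ2,
    d.monomial_eventually (dX 0) (dX 0) (dX 0) hρ2,
    d.monomial_eventually (dX 0) (dX 1) (dX 1) hρ2,
    d.monomial_eventually dT (dX 0) (dX 1) hρ2,
    d.monomial_eventually dT (dX 1) (dX 1) hρ2,
    d.monomial_eventually dT (dX 0) (dX 0) hρ2] with N h100 h111 h000 h011 hT01 hT11 hT00
  have hn := d.hn
  have l0 := d.phaseL_η_dX_zero
  have l1 := d.phaseL_η_dX_one
  have lT := d.phaseL_η_dT
  intro i z
  set χ := d.cutoff z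
  set o := osc d.η N 3 z
  fin_cases i
  · have e : d.wave N 0 z - d.waveMain N 0 z
        = -(pd (dX 1) (pd (dX 0) (pd (dX 0) (d.gpot N))) z
            - d.A * (phaseL d.η (dX 1) * phaseL d.η (dX 0) * phaseL d.η (dX 0)) * χ * o)
          - (pd (dX 1) (pd (dX 1) (pd (dX 1) (d.gpot N))) z
            - d.A * (phaseL d.η (dX 1) * phaseL d.η (dX 1) * phaseL d.η (dX 1)) * χ * o) := by
      simp only [wave_zero_apply, waveMain, Dvec_zero, l0, l1]
      linear_combination (d.A * χ * o * d.n 0) * hn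
    simp only [Fin.zero_eta] at e ⊢
    rw [e]
    calc _ ≤ |-(pd (dX 1) (pd (dX 0) (pd (dX 0) (d.gpot N))) z
            - d.A * (phaseL d.η (dX 1) * phaseL d.η (dX 0) * phaseL d.η (dX 0)) * χ * o)|
          + |pd (dX 1) (pd (dX 1) (pd (dX 1) (d.gpot N))) z
            - d.A * (phaseL d.η (dX 1) * phaseL d.η (dX 1) * phaseL d.η (dX 1)) * χ * o| :=
          abs_sub _ _
      _ ≤ ρ / 2 + ρ / 2 := by rw [abs_neg]; exact add_le_add (h100 z) (h111 z)
      _ = ρ := by ring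
  · have e : d.wave N 1 z - d.waveMain N 1 z
        = (pd (dX 0) (pd (dX 0) (pd (dX 0) (d.gpot N))) z
            - d.A * (phaseL d.η (dX 0) * phaseL d.η (dX 0) * phaseL d.η (dX 0)) * χ * o)
          + (pd (dX 0) (pd (dX 1) (pd (dX 1) (d.gpot N))) z
            - d.A * (phaseL d.η (dX 0) * phaseL d.η (dX 1) * phaseL d.η (dX 1)) * χ * o) := by
      simp only [wave_one_apply, waveMain, Dvec_one, l0, l1]
      linear_combination (d.A * χ * o * d.n 1) * hn
    simp only [Fin.mk_one] at e ⊢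
    rw [e]
    calc _ ≤ |pd (dX 0) (pd (dX 0) (pd (dX 0) (d.gpot N))) z
            - d.A * (phaseL d.η (dX 0) * phaseL d.η (dX 0) * phaseL d.η (dX 0)) * χ * o|
          + |pd (dX 0) (pd (dX 1) (pd (dX 1) (d.gpot N))) z
            - d.A * (phaseL d.η (dX 0) * phaseL d.η (dX 1) * phaseL d.η (dX 1)) * χ * o| :=
          abs_add_le _ _
      _ ≤ ρ / 2 + ρ / 2 := add_le_add (h000 z) (h011 z)
      _ = ρ := by ring
  · have e : d.wave N 2 z - d.waveMain N 2 z
        = 2 * (pd dT (pd (dX 0) (pd (dX 1) (d.gpot N))) z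
            - d.A * (phaseL d.η dT * phaseL d.η (dX 0) * phaseL d.η (dX 1)) * χ * o) := by
      simp only [wave_two_apply, waveMain, Dvec_two, l0, l1, lT]
      ring
    simp only [Fin.reduceFinMk] at e ⊢
    rw [e, abs_mul, abs_two]
    calc _ ≤ 2 * (ρ / 2) := by gcongr; exact hT01 z
      _ = ρ := by ring
  · have e : d.wave N 3 z - d.waveMain N 3 z
        = (pd dT (pd (dX 1) (pd (dX 1) (d.gpot N))) z
            - d.A * (phaseL d.η dT * phaseL d.η (dX 1) * phaseL d.η (dX 1)) * χ * o)
          - (pd dT (pd (dX 0) (pd (dX 0) (d.gpot N))) z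
            - d.A * (phaseL d.η dT * phaseL d.η (dX 0) * phaseL d.η (dX 0)) * χ * o) := by
      simp only [wave_three_apply, waveMain, Dvec_three, l0, l1, lT]
      ring
    simp only [Fin.reduceFinMk] at e ⊢
    rw [e]
    calc _ ≤ |pd dT (pd (dX 1) (pd (dX 1) (d.gpot N))) z
            - d.A * (phaseL d.η dT * phaseL d.η (dX 1) * phaseL d.η (dX 1)) * χ * o|
          + |pd dT (pd (dX 0) (pd (dX 0) (d.gpot N))) z
            - d.A * (phaseL d.η dT * phaseL d.η (dX 0) * phaseL d.η (dX 0)) * χ * o| :=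
          abs_sub _ _
      _ ≤ ρ / 2 + ρ / 2 := add_le_add (hT11 z) (hT00 z)
      _ = ρ := by ring



end WaveData

end Literature.Analysis.FluidPDE.ConvexIntegration
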